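import Summits.NavierStokesRegularity.NavierStokesRegularity.Theses.PalasekTowerBreakdown
import Summits.NavierStokesRegularity.FluidComputer.SmoothedHillVortexSobolev
import Summits.NavierStokesRegularity.FluidComputer.SmoothedHillVortexIntegrals
import Summits.NavierStokesRegularity.FluidComputer.SmoothedHillVortexLoop
import Summits.NavierStokesRegularity.FluidComputer.PalasekTowerRegisterGlobalFloorsAtSlice
import Summits.NavierStokesRegularity.FluidComputer.PalasekTowerRescaledCopy
import Summits.NavierStokesRegularity.FluidComputer.PalasekTowerBoxSchedule
import Summits.NavierStokesRegularity.FluidComputer.PalasekTowerHeredityWitnessCalibration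
import Summits.NavierStokesRegularity.FluidComputer.PalasekTowerHeredityWitnessRungs
import Literature.Analysis.FluidPDE.AxisymmetricNoSwirlGlobalHolds
import Literature.Analysis.FluidPDE.AxisymNoSwirlSpeedCapEighth
import Mathlib.Analysis.Real.Pi.Bounds

/-!
# The LAZY ENVELOPE SLICE: a smoothed Hill vortex carries the level-1 letter and the level-1
# ceiling of EVERY rigid design, yet its free Navier–Stokes run never reaches the level-2 floor

Cell `ns-blowup`, seat `ns-blowup-fc-prover-3` (g6). NEGATIVE-LANE support for the route item
`PalasekTowerBreakdown.HeredityAtOne` (= `HeredityAt 1`, stmt-NavierStokesRegularity-19249): the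
crux-strategist's target S⁺ = «slice heredity on the level-1 envelope» (STRATEGY-CENSUS §Strengthen (e),
crux idea `slice-heredity-envelope`, critic PASS) is REFUTED by an explicit object, vacuity-free.
LABEL: kernel; no named fact; ONE explicit smooth field and the tree's dynamics (Tao's `H^∞` local
theory + the Ladyzhenskaya–Ukhovskii–Yudovich a-priori bound ⇒ global swirl-free solutions,
`exists_isTaoSolutionOn_of_noSwirl`; the Gallay–Šverák cap `GallaySverak2015.speedCap_eighth` with the
Biot–Savart constant `1/(2√2)`). WHAT THIS IS NOT: not Navier–Stokes evidence about blow-up, and NOT a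
refutation of the crux: the slice is not (and, under the crux, provably cannot be) the `τ₁`-slice of a
REGISTERED level-1 stage; what it refutes is the design-free STRENGTHENING S⁺, i.e. it proves
«any proof of `HeredityAtOne` must use more about registered level-1 slices than letter + ceiling»
(`HeredityAtOne_false_without_History` in the census's words).

THE OBJECT. `lazySlice = hillField M a b` with `M = 3.92·10⁸`, `a = 1/216`, `b = 1/210` (tree
`FluidComputer/SmoothedHillVortex{Profile,Potential,Calculus,Field,Sobolev,Integrals,Loop}`): a `C^∞`,
divergence-free, axisymmetric, swirl-free field on `ℝ³` with `0 ≤ ω_θ/r ≤ M` supported in `|x| ≤ b`,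
speed `≤ M b²/3 < 2963` everywhere, centre speed `≥ M a²/3 > 2800`, strain `≥ (4M/5)/223 > 1.40·10⁶` at
`(1/223, 0, 0)`, circulation `M π/446³ > 13.8` around the meridional circle of radius `1/446` about
`(1/446, 0, 0)`; `H^∞` (dipole tail `|x|⁻³`, not Schwartz — a single-signed `ω_θ/r` is incompatible
with `L¹` velocity).

THE NUMBERS (tree `PalasekTowerHeredityWitnessCalibration`): `Y₁ < 2779 ≤ 2800` (floor),
`2963 ≤ (5/3)·2778 < c₂ Y₁` (ceiling), `A₁ < 1238361 ≤ 1.40·10⁶` (strain), `N₁^{β−2} < 6.234 ≤ 13.8`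
(core), `1/446 ≤ 1/N₁`, `2π/446 ≤ 8π/N₁` (`N₁ < 446`); and the CAP: for every Tao-class run `w` from the
slice, `‖w(t,x)‖ ≤ 0.35356 √(√((∫η)(∫r²η)) M) ≤ 0.35356 √(√((4π/3)M b³ · (4π/5)M b⁵) M) < 5702 < 6139 < Y₂`.

* §1 `lazyDesign` — the pinned rigid quiet wide design `Schedule.ofBox 0 0 1 0` (zero datum, zero force,
  radius `1`);
* §2 `lazySlice`, `letter_one_lazySlice` (`Letter S 1 lazySlice` for every schedule with `c₁ = 1` and
  `radius ≥ 1/223`), `norm_lazySlice_le` (`‖v‖ ≤ 2963`);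
* §3 `exists_freeRun_lazySlice` (the global swirl-free Tao-class run on any slab) and the cap
  `freeRun_norm_lt` (`‖w‖ < 5702`);
* §4 **`not_sliceRun_lazySlice`**: for EVERY rigid wide schedule `S`,
  `¬ SliceRun S 1 (fun S w => Letter S 2 w) lazySlice`; **`exists_lazy_envelope_slice`** — the `∃`-package
  of the census template `not_sliceHeredityAtOne_of_lazy_envelope_slice` VERBATIM (so `¬ SliceHeredityAtOne`
  is one line in the crux file); and BY NAME **`palasekTowerBreakdown_heredityAtOne_lazySlice_unregistered`**:
  under `PalasekTowerBreakdown.HeredityAtOne` the lazy slice is the `τ₁`-slice of NO registered level-1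
  stage of ANY pinned rigid quiet wide design.

References: S. Palasek, arXiv:2605.13827 §3–§4 [cite: Palasek2026ElementaryModel, §4]; Th. Gallay,
V. Šverák, Confluentes Math. 7 (2015), Prop. 2.6 (2.14), Lemma 5.1, Lemma 6.4
[cite: GallaySverak2016, Prop. 2.6 (2.14), Lemma 5.1, Lemma 6.4 (arXiv pp. 8, 16, 19)];
P. G. Lemarié-Rieusset, *The Navier–Stokes Problem in the 21st Century* (2016), Thm. 10.4
[cite: LemarieRieusset2016, Thm. 10.4 (p. 285)]; M. J. M. Hill, Phil. Trans. R. Soc. A 185 (1894)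
[cite: Hill1894, Art. 1–4].
-/

noncomputable section

namespace Summit.NavierStokesRegularity.HeredityAtOneLazySlice

open Set MeasureTheory Function Real
open scoped ENNReal ContDiff
open Literature.Analysis.FluidPDE
open Summit.NavierStokesRegularity.FluidComputer
open Summit.NavierStokesRegularity.FluidComputer.SmoothedHill
open Summit.NavierStokesRegularity.FluidComputer.PalasekTowerClayBridge
open Summit.NavierStokesRegularity.FluidComputer.PalasekTowerClayBridge.TowerRates
open Summit.NavierStokesRegularity.NavierStokesRegularity

/-! ## §1 The design -/

/-- **The lazy design**: the box schedule with ZERO datum, ZERO force, radius `1`, push constant `0`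
(rigid window clock, `c₁ = 1`, `c₂ = 5/3`). [cite: Palasek2026ElementaryModel, §3.3] -/
def lazyDesign : Schedule TowerRates.wide :=
  Schedule.ofBox 0 0 1 0 zero_le_one contDiff_const HasCompactSupport.zero
    (by simpa only [show uncurry (0 : ℝ → EuclideanSpace ℝ (Fin 3) → EuclideanSpace ℝ (Fin 3)) =
      fun _ => 0 from rfl] using contDiff_const)
    (by simpa only [show uncurry (0 : ℝ → EuclideanSpace ℝ (Fin 3) → EuclideanSpace ℝ (Fin 3)) =
      (0 : ℝ × EuclideanSpace ℝ (Fin 3) → EuclideanSpace ℝ (Fin 3)) from rfl]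
      using HasCompactSupport.zero)
    (fun _ _ _ => rfl) (fun _ _ _ => by simp)

/-- The lazy design is RIGID. [folklore] -/
theorem lazyDesign_rigid : lazyDesign.Rigid := Schedule.ofBox_rigid _ _ _ _ _ _ _

/-- The lazy design is QUIET. [folklore] -/
theorem lazyDesign_quiet : lazyDesign.Quiet := Schedule.ofBox_quiet _ _ _ _ _ _ _

/-- The lazy design is PINNED with `Λ = 8`, `θ = 6/5`. [folklore] -/
theorem lazyDesign_pins : lazyDesign.Pins 8 (6 / 5) :=
  Schedule.ofBox_pins _ _ _ _ _ _ _ (fun _ _ => rfl) (fun _ _ _ => rfl)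

/-- The lazy design's ball has radius `1`. [folklore] -/
@[simp] theorem lazyDesign_radius : lazyDesign.radius = 1 := rfl

/-- The lazy design's floor constant is `1`. [folklore] -/
@[simp] theorem lazyDesign_c₁ : lazyDesign.c₁ = 1 := rfl

/-! ## §2 The slice -/

/-- The vorticity-quotient level `M = 3.92·10⁸`. [folklore] -/
def lvl : ℝ := 392000000

/-- The core radius `a = 1/216`. [folklore] -/
def rIn : ℝ := 1 / 216

/-- The outer radius `b = 1/210`. [folklore] -/
def rOut : ℝ := 1 / 210

/-- **The lazy slice**: the smoothed Hill vortex with `M = 3.92·10⁸`, `a = 1/216`, `b = 1/210`.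
[cite: Hill1894, Art. 1–4] -/
def lazySlice : EuclideanSpace ℝ (Fin 3) → EuclideanSpace ℝ (Fin 3) := hillField lvl rIn rOut

/-- `0 ≤ M`. [folklore] -/
theorem lvl_nonneg : (0 : ℝ) ≤ lvl := by norm_num [lvl]

/-- `0 < a`. [folklore] -/
theorem rIn_pos : (0 : ℝ) < rIn := by norm_num [rIn]

/-- `a < b`. [folklore] -/
theorem rIn_lt_rOut : rIn < rOut := by norm_num [rIn, rOut]

/-- **Speed ceiling**: `‖v(x)‖ ≤ M b²/3 < 2963` everywhere. [folklore] -/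
theorem norm_lazySlice_le (x : EuclideanSpace ℝ (Fin 3)) : ‖lazySlice x‖ ≤ 2963 := by
  have h := norm_hillField_le lvl_nonneg rIn_pos rIn_lt_rOut x
  have hn : lvl * rOut ^ 2 / 3 ≤ 2963 := by norm_num [lvl, rOut]
  exact h.trans hn

/-- **Speed floor at the centre**: `2800 ≤ M a²/3 ≤ ‖v(0)‖`. [folklore] -/
theorem le_norm_lazySlice_zero : (2800 : ℝ) ≤ ‖lazySlice 0‖ := by
  have h := le_norm_hillField_zero lvl_nonneg rIn_pos rIn_lt_rOut
  have hn : (2800 : ℝ) ≤ lvl * rIn ^ 2 / 3 := by norm_num [lvl, rIn]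
  exact hn.trans h

/-- The strain point `P = (1/223, 0, 0)`. [folklore] -/
def strainPt : EuclideanSpace ℝ (Fin 3) := !₂[1 / 223, 0, 0]

/-- **Strain floor**: `1.40·10⁶ ≤ (4M/5)/223 ≤ ‖Dv(P)‖`. [folklore] -/
theorem le_norm_fderiv_lazySlice : (1400000 : ℝ) ≤ ‖fderiv ℝ lazySlice strainPt‖ := by
  have hx : rsq strainPt < rIn ^ 2 := by
    have h0 : strainPt 0 = 1 / 223 := by simp [strainPt]
    have h1 : strainPt 1 = 0 := by simp [strainPt]
    have h2 : strainPt 2 = 0 := by simp [strainPt]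
    rw [rsq, h0, h1, h2, rIn]
    norm_num
  have h := norm_fderiv_hillField_ge (M := lvl) rIn_pos rIn_lt_rOut hx
  have hP : strainPt 0 = 1 / 223 := by simp [strainPt]
  rw [hP] at h
  have hn : (1400000 : ℝ) ≤ 4 * lvl / 5 * |(1 : ℝ) / 223| := by
    rw [abs_of_pos (by norm_num)]; norm_num [lvl]
  exact hn.trans h

/-- The loop centre `c = (1/446, 0, 0)`. [folklore] -/
def loopCentre : EuclideanSpace ℝ (Fin 3) := !₂[1 / 446, 0, 0]

/-- **Core circulation**: `13.8 ≤ M π / 446³ = ∮ v · dγ` around the meridional circle of radius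
`1/446` about the loop centre. [folklore] -/
theorem le_circulation_lazySlice :
    (13.8 : ℝ) ≤ circulation lazySlice (coreLoop (1 / 446) (1 / 446)) := by
  have h := circulation_hillField_coreLoop (M := lvl) (c₀ := 1 / 446) (r₀ := 1 / 446) rIn_pos
    rIn_lt_rOut (by norm_num) (by norm_num) (by norm_num [rIn])
  rw [lazySlice, h]
  have hπ := Real.pi_gt_d2
  norm_num [lvl]
  nlinarith

/-- **The lazy slice carries the LEVEL-1 LETTER** of every wide schedule with floor constant `c₁ = 1`
and radius `≥ 1/223` (speed `≥ Y₁` at the centre, strain `≥ A₁` at `(1/223,0,0)`, an `N₁`-core loop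
about `(1/446,0,0)`). [cite: Palasek2026ElementaryModel, §3.1] -/
theorem letter_one_lazySlice (S : Schedule TowerRates.wide) (hc : S.c₁ = 1) (hr : 1 / 223 ≤ S.radius) :
    Letter S 1 lazySlice := by
  have hY := wide_Y_one_bounds
  have hA := wide_A_one_bounds
  have hN := wide_N_one_bounds
  have hNβ := wide_N_one_rpow_bounds
  refine ⟨⟨0, by simp; linarith, ?_⟩, ⟨strainPt, ?_, ?_⟩, ⟨loopCentre, coreLoop (1 / 446) (1 / 446), ?_,
    contDiff_coreLoop _ _, coreLoop_zero_eq_one _ _, fun σ _ => ?_, fun σ _ => ?_, ?_⟩⟩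
  · rw [hc, one_mul]; exact le_trans (by linarith) le_norm_lazySlice_zero
  · have : ‖strainPt‖ = 1 / 223 := by
      rw [EuclideanSpace.norm_eq, Fin.sum_univ_three]
      simp [strainPt]
    rw [this]; exact hr
  · rw [hc, one_mul]; exact le_trans (by linarith) le_norm_fderiv_lazySlice
  · have : ‖loopCentre‖ = 1 / 446 := by
      rw [EuclideanSpace.norm_eq, Fin.sum_univ_three]
      simp [loopCentre]
    rw [this]; linarith
  · have h := coreLoop_mem_closedBall (1 / 446) (1 / 446) σ
    rw [abs_of_pos (by norm_num)] at h
    have e : (!₂[(1:ℝ) / 446, 0, 0] : EuclideanSpace ℝ (Fin 3)) = loopCentre := rfl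
    rw [e] at h
    refine Metric.closedBall_subset_closedBall ?_ h
    rw [div_le_div_iff₀ (by norm_num) (lt_trans (by norm_num) hN.1)]
    linarith
  · rw [norm_deriv_coreLoop, abs_of_pos (by norm_num)]
    rw [le_div_iff₀ (hN.1.trans' (by norm_num))]
    nlinarith [Real.pi_pos]
  · rw [hc, one_mul]
    exact le_trans (by linarith) le_circulation_lazySlice

/-! ## §3 The free run and its speed cap -/

/-- The lazy slice is smooth, divergence free, `H^∞`, axisymmetric and swirl free: the hypotheses of the
swirl-free global theory. [folklore] -/
theorem lazySlice_regular :
    ContDiff ℝ ∞ lazySlice ∧ VectorCalculus.IsDivFree lazySlice ∧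
      (∀ n : ℕ, ∫⁻ x, ‖iteratedFDeriv ℝ n lazySlice x‖ₑ ^ 2 < ⊤) ∧
      IsAxisymmetric lazySlice ∧ HasNoSwirl lazySlice :=
  ⟨contDiff_hillField _ _ _, isDivFree_hillField _ _ _,
    fun n => lintegral_iteratedFDeriv_hillField_lt_top rIn_pos rIn_lt_rOut n,
    isAxisymmetric_hillField _ _ _, hasNoSwirl_hillField _ _ _⟩

/-- **The free run exists globally**: for every `T > 0` the unforced Navier–Stokes system at unit
viscosity has a Tao-class (classical, `H^∞`, `C_t L²`) solution on `[0, T]` from the lazy slice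
(Ladyzhenskaya–Ukhovskii–Yudovich through Tao's local theory, all discharged in the tree).
[cite: LemarieRieusset2016, Thm. 10.4 (p. 285)] -/
theorem exists_freeRun_lazySlice {T : ℝ} (hT : 0 < T) :
    ∃ (w : ℝ → EuclideanSpace ℝ (Fin 3) → EuclideanSpace ℝ (Fin 3))
      (r : ℝ → EuclideanSpace ℝ (Fin 3) → ℝ), IsTaoSolutionOn T 1 lazySlice w r :=
  have h := lazySlice_regular
  exists_isTaoSolutionOn_of_noSwirl tao2011_smooth_local_existence_holds
    axisymmetricNoSwirl_enstrophy_apriori_holds one_pos h.1 h.2.1 h.2.2.1 h.2.2.2.1 h.2.2.2.2 hT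

/-- **THE CAP**: every Tao-class run from the lazy slice stays slower than `5702` — below the
level-2 floor `Y₂ > 6139` — for all time (`GallaySverak2015.speedCap_eighth` with
`∫ ω_θ/r ≤ (4π/3) M b³`, `∫ r² ω_θ/r ≤ (4π/5) M b⁵`, `ω_θ/r ≤ M`, `π < 3.15`).
[cite: GallaySverak2016, Prop. 2.6 (2.14), Lemma 5.1, Lemma 6.4 (arXiv pp. 8, 16, 19)] -/
theorem freeRun_norm_lt {T : ℝ} (hT : 0 < T)
    {w : ℝ → EuclideanSpace ℝ (Fin 3) → EuclideanSpace ℝ (Fin 3)} {r : ℝ → EuclideanSpace ℝ (Fin 3) → ℝ}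
    (hw : IsTaoSolutionOn T 1 lazySlice w r) : ∀ t ∈ Icc 0 T, ∀ x, ‖w t x‖ < 5702 := by
  intro t ht x
  have hreg := lazySlice_regular
  have hcap := GallaySverak2015.speedCap_eighth hT hw hreg.2.2.2.1 hreg.2.2.2.2
    (angVortQuot_hillField_nonneg lvl_nonneg rIn_pos rIn_lt_rOut)
    (angVortQuot_hillField_le lvl_nonneg rIn_pos rIn_lt_rOut)
    (integrable_angVortQuot_hillField rIn_pos rIn_lt_rOut)
    (integrable_cylRadius_sq_mul_angVortQuot_hillField rIn_pos rIn_lt_rOut) t ht x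
  refine lt_of_le_of_lt hcap ?_
  -- the two integrals
  set I₁ := ∫ y, angVortQuot lazySlice y with hI₁
  set I₂ := ∫ y, cylRadius y ^ 2 * angVortQuot lazySlice y with hI₂
  have hI₁0 : 0 ≤ I₁ := integral_nonneg (angVortQuot_hillField_nonneg lvl_nonneg rIn_pos rIn_lt_rOut)
  have hI₂0 : 0 ≤ I₂ := integral_nonneg fun y =>
    mul_nonneg (sq_nonneg _) (angVortQuot_hillField_nonneg lvl_nonneg rIn_pos rIn_lt_rOut y)
  have hI₁le : I₁ ≤ 4 * π / 3 * lvl * rOut ^ 3 :=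
    integral_angVortQuot_hillField_le lvl_nonneg rIn_pos rIn_lt_rOut
  have hI₂le : I₂ ≤ 4 * π / 5 * lvl * rOut ^ 5 :=
    integral_cylRadius_sq_mul_angVortQuot_hillField_le lvl_nonneg rIn_pos rIn_lt_rOut
  have hπ := Real.pi_lt_d2
  have hπ0 := Real.pi_pos
  -- numerics: I₁ I₂ ≤ 0.44
  have hprod : I₁ * I₂ ≤ 0.44 := by
    have h1 : 4 * π / 3 * lvl * rOut ^ 3 ≤ 178 := by norm_num [lvl, rOut]; nlinarith
    have h2 : 4 * π / 5 * lvl * rOut ^ 5 ≤ 0.002419 := by norm_num [lvl, rOut]; nlinarith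
    calc I₁ * I₂ ≤ 178 * 0.002419 := mul_le_mul (hI₁le.trans h1) (hI₂le.trans h2) hI₂0 (by norm_num)
      _ ≤ 0.44 := by norm_num
  have hs1 : Real.sqrt (I₁ * I₂) ≤ 0.6634 := by
    rw [Real.sqrt_le_iff]; exact ⟨by norm_num, hprod.trans (by norm_num)⟩
  have hs2 : Real.sqrt (I₁ * I₂) * lvl ≤ 0.6634 * 392000000 := by
    unfold lvl; exact mul_le_mul_of_nonneg_right hs1 (by norm_num)
  have hs3 : Real.sqrt (Real.sqrt (I₁ * I₂) * lvl) ≤ 16127 := by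
    rw [Real.sqrt_le_iff]; exact ⟨by norm_num, hs2.trans (by norm_num)⟩
  calc 0.35356 * Real.sqrt (Real.sqrt (I₁ * I₂) * lvl) ≤ 0.35356 * 16127 :=
        mul_le_mul_of_nonneg_left hs3 (by norm_num)
    _ < 5702 := by norm_num

/-! ## §4 The refutations -/

/-- **No rigid design's free-run schema holds on the lazy slice**: for EVERY rigid wide schedule `S`
(window `τ₂ − τ₁ > 0`, `c₁ = 1`, `c₂ = 5/3`), the global swirl-free run from the lazy slice is an
unforced finite-energy classical solution on the window slab inside the ceiling `(5/3) Y₂`, whose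
terminal slice has speed `< 5702 < Y₂` EVERYWHERE — so it is not a level-2 letter in any ball.
[cite: Palasek2026ElementaryModel, §4] -/
theorem not_sliceRun_lazySlice (S : Schedule TowerRates.wide) (hR : S.Rigid) :
    ¬ SliceRun S 1 (fun S w => Letter S 2 w) lazySlice := by
  intro hrun
  have hT : 0 < S.τ 2 - S.τ 1 := by linarith [S.τ_lt_succ 1]
  obtain ⟨w, r, hw⟩ := exists_freeRun_lazySlice hT
  have hY2 := wide_Y_two_bounds
  have hcap := freeRun_norm_lt hT hw
  have hE : ∃ C : ℝ≥0∞, C < ⊤ ∧ ∀ σ ∈ Icc 0 (S.τ (1 + 1) - S.τ 1), ∫⁻ x, ‖w σ x‖ₑ ^ 2 ≤ C := by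
    obtain ⟨C, hC⟩ := hw.sobolev 0
    exact ⟨C, ENNReal.coe_lt_top, fun σ hσ => by
      rw [lintegral_enorm_sq_eq_lintegral_iteratedFDeriv_zero]; exact hC σ hσ⟩
  have hB : ∀ σ ∈ Icc 0 (S.τ (1 + 1) - S.τ 1), ∀ x, ‖w σ x‖ ≤ S.c₂ * TowerRates.wide.Y (1 + 1) := by
    intro σ hσ x
    rw [hR.c₂_eq]
    have := hcap σ hσ x
    linarith [hY2.1]
  have hL := hrun w r hw.classical hw.initial hE hB
  obtain ⟨⟨x, -, hx⟩, -, -⟩ := hL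
  rw [hR.c₁_eq, one_mul] at hx
  have := hcap (S.τ (1 + 1) - S.τ 1) ⟨hT.le, le_rfl⟩ x
  linarith [hY2.1]

/-- In particular on the lazy design itself. [cite: Palasek2026ElementaryModel, §4] -/
theorem not_sliceRun_lazySlice_lazyDesign :
    ¬ SliceRun lazyDesign 1 (fun S w => Letter S 2 w) lazySlice :=
  not_sliceRun_lazySlice lazyDesign lazyDesign_rigid

/-- **The lazy slice is a LEVEL-1 ENVELOPE SLICE of the lazy design**: it carries the level-1 letter
and the level-1 ceiling `c₂ Y₁`. [cite: Palasek2026ElementaryModel, §3.1] -/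
theorem envelope_lazySlice :
    Letter lazyDesign 1 lazySlice ∧ ∀ x, ‖lazySlice x‖ ≤ lazyDesign.c₂ * TowerRates.wide.Y 1 := by
  refine ⟨letter_one_lazySlice lazyDesign rfl (by norm_num [lazyDesign_radius]), fun x => ?_⟩
  rw [lazyDesign_rigid.c₂_eq]
  have hY := wide_Y_one_bounds
  linarith [norm_lazySlice_le x, hY.1]

/-- **THE `∃`-PACKAGE OF THE CENSUS TEMPLATE, VERBATIM** (crux workfile
`Cruxes/HeredityAtOne/StrategyCensus.lean`, `not_sliceHeredityAtOne_of_lazy_envelope_slice`): ONE pinned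
rigid quiet wide design, ONE envelope slice (letter + ceiling at level `1`), ONE unforced finite-energy
classical run of length `τ₂ − τ₁` from it inside the ceiling `c₂ Y₂` whose terminal slice is NOT a
level-2 letter. Hence `¬ SliceHeredityAtOne` (S⁺ of the strategy census is FALSE).
[cite: Palasek2026ElementaryModel, §4] -/
theorem exists_lazy_envelope_slice :
    ∃ (S : Schedule TowerRates.wide) (v : EuclideanSpace ℝ (Fin 3) → EuclideanSpace ℝ (Fin 3))
      (w : ℝ → EuclideanSpace ℝ (Fin 3) → EuclideanSpace ℝ (Fin 3)) (r : ℝ → EuclideanSpace ℝ (Fin 3) → ℝ),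
      S.Pins 8 (6 / 5) ∧ S.Rigid ∧ S.Quiet ∧ (Letter S 1 v ∧ ∀ x, ‖v x‖ ≤ S.c₂ * TowerRates.wide.Y 1) ∧
      IsClassicalNSSolutionOn (Icc 0 (S.τ 2 - S.τ 1)) 1 0 w r ∧ w 0 = v ∧
      (∃ C : ℝ≥0∞, C < ⊤ ∧ ∀ σ ∈ Icc 0 (S.τ 2 - S.τ 1), ∫⁻ x, ‖w σ x‖ₑ ^ 2 ≤ C) ∧
      (∀ σ ∈ Icc 0 (S.τ 2 - S.τ 1), ∀ x, ‖w σ x‖ ≤ S.c₂ * TowerRates.wide.Y 2) ∧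
      ¬ Letter S 2 (w (S.τ 2 - S.τ 1)) := by
  have hT : 0 < lazyDesign.τ 2 - lazyDesign.τ 1 := by linarith [lazyDesign.τ_lt_succ 1]
  obtain ⟨w, r, hw⟩ := exists_freeRun_lazySlice hT
  have hY2 := wide_Y_two_bounds
  have hcap := freeRun_norm_lt hT hw
  refine ⟨lazyDesign, lazySlice, w, r, lazyDesign_pins, lazyDesign_rigid, lazyDesign_quiet,
    envelope_lazySlice, hw.classical, hw.initial, ?_, fun σ hσ x => ?_, ?_⟩
  · obtain ⟨C, hC⟩ := hw.sobolev 0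
    exact ⟨C, ENNReal.coe_lt_top, fun σ hσ => by
      rw [lintegral_enorm_sq_eq_lintegral_iteratedFDeriv_zero]; exact hC σ hσ⟩
  · rw [lazyDesign_rigid.c₂_eq]
    have := hcap σ hσ x
    linarith [hY2.1]
  · rintro ⟨⟨x, -, hx⟩, -, -⟩
    rw [lazyDesign_c₁, one_mul] at hx
    have := hcap (lazyDesign.τ 2 - lazyDesign.τ 1) ⟨hT.le, le_rfl⟩ x
    linarith [hY2.1]

/-- **BY NAME — under the crux the lazy slice is NEVER REGISTERED**: if
`PalasekTowerBreakdown.HeredityAtOne` holds then, for every pinned rigid quiet wide design `S` and every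
registered level-1 stage `s` of `S`, the `τ₁`-slice of `s` is not the lazy slice (the crux gives
`ReadoutFloorsAt 1`, i.e. the free-run schema on every registered slice; the schema fails on the lazy
slice for every rigid `S`). A proof of the crux must therefore use a property of registered level-1
slices beyond «letter + ceiling». [cite: Palasek2026ElementaryModel, §4] -/
theorem palasekTowerBreakdown_heredityAtOne_lazySlice_unregistered
    (h : Theses.PalasekTowerBreakdown.HeredityAtOne)
    {S : Schedule TowerRates.wide} (hP : S.Pins 8 (6 / 5)) (hR : S.Rigid) (hQ : S.Quiet)
    (s : Stage 1 TowerRates.wide S (Margins.routeG TowerRates.wide) 1) : s.u (S.τ 1) ≠ lazySlice := by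
  intro hs
  have hF : ReadoutFloorsAt 1 := PalasekTowerClayBridge.HeredityAtOne.readoutFloorsAt h
  have hrun := readoutFloorsAt_one_iff_sliceRun.1 hF S hP hR hQ s
  rw [hs] at hrun
  exact not_sliceRun_lazySlice S hR hrun

end Summit.NavierStokesRegularity.HeredityAtOneLazySlice

end
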